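import Mathlib.RingTheory.Polynomial.Basic
import Mathlib.Algebra.CharP.Lemmas
import Mathlib.Algebra.CharP.Frobenius
import Mathlib.Algebra.Ring.GeomSum
import Mathlib.RingTheory.Ideal.Maps
import HarnessLib

/-!
# The Fedder sandwich for a purely inseparable `p`-cyclic cover

Let `A` be a commutative ring of prime characteristic `p`, `I ≤ A` an ideal, `f c : A` and
`q = p ^ (e + 1)`.  Writing `J^[q]` for the ideal generated by the `q`-th powers of the elements
of an ideal `J`, we prove the dictionary

`C c * (X ^ p - C f) ^ (q - 1) ∈ (I·A[X] + (X))^[q] ↔ c * f ^ (q - q / p) ∈ I^[q]`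

in `A[X]` (the cover `A[X]/(X^p - f)` being F-pure / F-regular along `I` exactly when `f` sits in
the F-pure-threshold window, by Fedder's criterion).

Proof.  (1) `(X^p - C f)^(q-1) = ∑_{i<q} X^{p i} · C f^{q-1-i}`: multiply the geometric sum by
the monic (hence regular) `X^p - C f` and use `(a - b)^q = a^q - b^q` (Frobenius).  (2) The `q`-th
Frobenius power of `I·A[X] + (X)` is `I^[q]·A[X] + (X^q)`, since the `q`-th power map is the ring
endomorphism `iterateFrobenius` and Frobenius powers are `Ideal.map` along it.  (3) Every
coefficient of degree `< q` of a member of `K·A[X] + (X^q)` lies in `K`; reading off the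
coefficient of `X^{q-p}` gives `⇒`, and `⇐` is checked term by term.
-/

-- single-problem summit: the doubled namespace component is forced
set_option linter.dupNamespace false

noncomputable section

open Polynomial

namespace Summit.ResolutionOfSingularities.ResolutionOfSingularities.Theorems.FRationalResolution

/-- Expansion of `C c * (X ^ p - C f) ^ (q - 1)` for `q = p ^ (e + 1)` in characteristic `p`:
it is `∑_{i<q} C (c * f ^ (q - 1 - i)) * X ^ (p * i)`. -/
theorem fedderSandwich_expand (p : ℕ) (hp : p.Prime) (A : Type) [CommRing A] [CharP A p]
    (f c : A) (e : ℕ) :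
    C c * (X ^ p - C f) ^ (p ^ (e + 1) - 1) =
      ∑ i ∈ Finset.range (p ^ (e + 1)), C (c * f ^ (p ^ (e + 1) - 1 - i)) * X ^ (p * i) := by
  haveI : ExpChar A p := ExpChar.prime hp
  have key : (X ^ p - C f : A[X]) ^ (p ^ (e + 1) - 1) =
      ∑ i ∈ Finset.range (p ^ (e + 1)), (X ^ p) ^ i * (C f) ^ (p ^ (e + 1) - 1 - i) := by
    have hmul : (X ^ p - C f : A[X]) ^ (p ^ (e + 1) - 1) * (X ^ p - C f) =
        (∑ i ∈ Finset.range (p ^ (e + 1)), (X ^ p) ^ i * (C f) ^ (p ^ (e + 1) - 1 - i)) *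
          (X ^ p - C f) := by
      rw [pow_sub_one_mul (pow_ne_zero _ hp.ne_zero), geom_sum₂_mul, sub_pow_expChar_pow]
    exact (monic_X_pow_sub_C f hp.ne_zero).isRegular.right hmul
  rw [key, Finset.mul_sum]
  refine Finset.sum_congr rfl fun i _ => ?_
  rw [← pow_mul, ← C_pow, C_mul]
  ring

/-- The `q`-th Frobenius power of `I·A[X] + (X)` is `I^[q]·A[X] + (X ^ q)` (`q = p ^ (e + 1)`,
characteristic `p`). -/
theorem fedderSandwich_idealEq (p : ℕ) (hp : p.Prime) (A : Type) [CommRing A] [CharP A p]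
    (I : Ideal A) (e : ℕ) :
    Ideal.span ((fun g : A[X] => g ^ p ^ (e + 1)) ''
        ((I.map C ⊔ Ideal.span {X} : Ideal A[X]) : Set A[X])) =
      (Ideal.span ((fun z : A => z ^ p ^ (e + 1)) '' (I : Set A))).map C ⊔
        Ideal.span {(X : A[X]) ^ p ^ (e + 1)} := by
  haveI : ExpChar A p := ExpChar.prime hp
  have hcomp : (iterateFrobenius A[X] p (e + 1)).comp C = C.comp (iterateFrobenius A p (e + 1)) :=
    RingHom.ext fun z => by simp only [RingHom.comp_apply, iterateFrobenius_def, map_pow]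
  change Ideal.map (iterateFrobenius A[X] p (e + 1)) (I.map C ⊔ Ideal.span {X}) =
    (Ideal.map (iterateFrobenius A p (e + 1)) I).map C ⊔ Ideal.span {(X : A[X]) ^ p ^ (e + 1)}
  rw [Ideal.map_sup, Ideal.map_span, Set.image_singleton, iterateFrobenius_def, Ideal.map_map,
    Ideal.map_map, hcomp]

/-- Coefficients of degree `< q` of a member of `K·A[X] + (X ^ q)` lie in `K`. -/
theorem fedderSandwich_coeff_mem {A : Type} [CommRing A] (K : Ideal A) (q : ℕ) {P : A[X]}
    (hP : P ∈ K.map C ⊔ Ideal.span {(X : A[X]) ^ q}) (n : ℕ) (hn : n < q) :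
    P.coeff n ∈ K := by
  obtain ⟨a, ha, b, hb, rfl⟩ := Submodule.mem_sup.mp hP
  obtain ⟨h, rfl⟩ := Ideal.mem_span_singleton'.mp hb
  rw [coeff_add, mul_comm h, coeff_X_pow_mul', if_neg (not_le.mpr hn), add_zero]
  exact Ideal.mem_map_C_iff.mp ha n

/-- **Fedder sandwich.** For `q = p ^ (e + 1)` in characteristic `p`:
`C c * (X ^ p - C f) ^ (q - 1) ∈ (I·A[X] + (X))^[q] ↔ c * f ^ (q - p ^ e) ∈ I^[q]`, where
`J^[q]` is the ideal generated by `q`-th powers of elements of `J`. -/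
theorem fedderSandwich (p : ℕ) (hp : p.Prime) (A : Type) [CommRing A] [CharP A p] (I : Ideal A)
    (f c : A) (e : ℕ) :
    Polynomial.C c * (Polynomial.X ^ p - Polynomial.C f) ^ (p ^ (e + 1) - 1) ∈
        Ideal.span ((fun g : Polynomial A => g ^ p ^ (e + 1)) ''
          ((I.map Polynomial.C ⊔ Ideal.span {Polynomial.X} : Ideal (Polynomial A)) :
            Set (Polynomial A))) ↔
      c * f ^ (p ^ (e + 1) - p ^ e) ∈
        Ideal.span ((fun z : A => z ^ p ^ (e + 1)) '' (I : Set A)) := by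
  rw [fedderSandwich_expand p hp A f c e, fedderSandwich_idealEq p hp A I e]
  have hpe1 : 1 ≤ p ^ e := Nat.one_le_pow _ _ hp.pos
  have hq : p ^ (e + 1) = p * p ^ e := pow_succ' p e
  have hpe : p ^ e ≤ p ^ (e + 1) := Nat.pow_le_pow_right hp.pos (Nat.le_succ e)
  constructor
  · intro h
    have hlt : p * (p ^ e - 1) < p ^ (e + 1) := by
      rw [hq]
      exact mul_lt_mul_of_pos_left (Nat.sub_lt hpe1 one_pos) hp.pos
    have hmem := fedderSandwich_coeff_mem _ _ h (p * (p ^ e - 1)) hlt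
    have hco : (∑ i ∈ Finset.range (p ^ (e + 1)),
        C (c * f ^ (p ^ (e + 1) - 1 - i)) * X ^ (p * i)).coeff (p * (p ^ e - 1)) =
          c * f ^ (p ^ (e + 1) - p ^ e) := by
      rw [finsetSum_coeff,
        Finset.sum_eq_single_of_mem (p ^ e - 1) (Finset.mem_range.mpr (by omega)),
        coeff_C_mul_X_pow, if_pos rfl]
      · congr 2
        omega
      · intro i _ hne
        rw [coeff_C_mul_X_pow, if_neg]
        exact fun h' => hne (mul_left_cancel₀ hp.ne_zero h').symm
    rw [hco] at hmem
    exact hmem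
  · intro h
    refine sum_mem fun i _ => ?_
    rcases Nat.lt_or_ge i (p ^ e) with hi | hi
    · refine Ideal.mem_sup_left (Ideal.mul_mem_right _ _ (Ideal.mem_map_of_mem C ?_))
      have hsplit : p ^ (e + 1) - 1 - i = (p ^ (e + 1) - p ^ e) + (p ^ e - 1 - i) := by omega
      rw [hsplit, pow_add f (p ^ (e + 1) - p ^ e) (p ^ e - 1 - i), ← mul_assoc]
      exact Ideal.mul_mem_right _ _ h
    · refine Ideal.mem_sup_right (Ideal.mul_mem_left _ _ (Ideal.mem_span_singleton.mpr ?_))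
      refine pow_dvd_pow X ?_
      calc p ^ (e + 1) = p * p ^ e := hq
        _ ≤ p * i := Nat.mul_le_mul_left p hi

end Summit.ResolutionOfSingularities.ResolutionOfSingularities.Theorems.FRationalResolution

end
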